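import Summits.NavierStokesRegularity.NavierStokesRegularity.Theorems.StrainDoorsQuadrupole
import Summits.NavierStokesRegularity.NavierStokesRegularity.Theorems.StrainDoorsLocalNewtonB3
import HarnessLib

/-!
# StrainDoorsMagicCone — the 𝒬-form of local parity, the magic-cone sign of the near kernel, door D11, and the
# BLOW-UP ALTERNATIVE (layer-type / tube-type)

nsreg-p1 g34 ROUND-48 (cell ns-regularity-ideate, rung N0, helper lane of `stmt-NavierStokesRegularity-0056`;
`--supports 0056 --as helper`).  Everything here is PROVED (std axioms) from the tree: door D8 `localNewtonParityDoor_holds`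
(⇐ B3, `StrainDoorsLocalNewtonB3`) and the R47 difference-form machinery (`StrainDoorsQuadrupole`).

§18 THE 𝒬-FORM (kernel-checked).  In the door frame the pressure-free near feed of D8 collapses to TWO terms:
  `newtonNearFeed r₀ r₁ u t x e = ¼(|ω(x)|² − ω_e(x)²) − 𝒬_{r₀r₁}(x,e)`,   `𝒬 := ∫ K_ee(x − y) (q(y) − q(x)) dy`
(`newtonNearFeed_eq_quarter_sub_qExcessMoment`; `q = ½|ω|² − |S|² = qDensity`, `K_ee = newtonNearHess r₀ r₁ e e`).  `𝒬` is the
QUADRUPOLE MOMENT OF THE Q-EXCESS seen from the record point along the stretching direction.  Hence D8's parity hypothesis reads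
  `¼|ω⊥e|²(x) − λ_max² ≤ 𝒬_{r₀r₁}(x,e)`                                                        (`newtonNearFeed_le_sq_iff`)
— restricted-Euler defect AT the point ≤ quadrupole moment of the Q-excess AROUND it (the four-term split of R46 regroups to this).

§19 THE MAGIC CONE.  Inside the inner radius `K_ee(z) = (|z|² − 3⟨z,e⟩²)/(4π|z|⁵)`, so `K_ee(z) ≥ 0 ↔ 3⟨z,e⟩² ≤ |z|²`
(`newtonNearHess_self_nonneg_iff`): Q-excess located at polar angle `> arccos(1/√3) ≈ 54.7°` from `±e` COMPRESSES the record
strain (helps parity), Q-excess inside the magic double cone FEEDS it.  Values: `+1/(4π|z|³)` at `z ⟂ e`, `−1/(8π|z|³)` at 45°,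
`−1/(2π|z|³)` at `z ∥ e` (`newtonNearHess_self_of_inner_eq_zero / _of_sq_inner_eq_half / _of_sq_inner_eq_sq`).  A concentrated
vortex induces its maximal strain at 45° from the separation vector — INSIDE the cone: vortex-induced record strain is
quadrupole-FED (the structural reason for R47's Burgers census, `𝒬 < 0` outside the window).

§20 DOOR D11 «MagicConeDoor» (PROVED ⇐ D8) and the BLOW-UP ALTERNATIVE.  D11: if on `[t₀,T)` at every charged `δ`-almost strain
maximiser (i) the Q-excess is FAVOURABLY SEGREGATED, `K_ee(x − y)(q(y) − q(x)) ≥ 0` for all `y`, and (ii) the pointwise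
restricted-Euler parity `|ω⊥e|² ≤ 4λ_max²` holds, the solution continues (`magicConeDoor_holds`) — two SIGN conditions, no
constant, no budget.  Contrapositive of D8 in 𝒬-form (`blowup_alternative`): if the solution does NOT extend past `T`, then for
every `t₀ < T`, level `l₀`, tolerance `δ` and scales `r₀ < r₁` there is a charged near-record strain point with
  (F1) TRANSVERSE VORTICITY `|ω⊥e|² > 4λ_max²`  [layer-type]   or   (F2) FED GEOMETRY `𝒬_{r₀r₁}(x,e) < 0`  [tube-type].
§21 records the exact algebra of the stretched shear layer `∇u = [[−α,0,0],[κ,0,0],[0,0,α]]` (Burgers vortex layer / Kelvin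
mode): its record strain `l` solves `l² + αl = κ²/4` and its F1-defect is `κ²/4 − l² = α·l` EXACTLY (`layerStrain_le`,
`layer_defect`) — the «α·λ law» of R47 §(3)(iv) in closed form.
HONEST FRAME: a reformulation, a corollary door and a proved alternative, all downstream of D8 (same open-free status: D8 is
closed by B3); 0056 `NoTypeII` / 10661 / NS regularity NOT proved; no blow-up scenario excluded.
-/

noncomputable section

open MeasureTheory Set Function Filter Metric Real InnerProductSpace intervalIntegral
open _root_.Topology
open scoped ENNReal NNReal RealInnerProductSpace ContDiff Laplacian
open Literature.Analysis Literature.Analysis.FluidPDE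
open Literature.Analysis.FluidPDE.VorticityDirectionDynamics

set_option linter.dupNamespace false

namespace Summit.NavierStokesRegularity.NavierStokesRegularity.Theorems.StrainDoors

/-! ## §18  The 𝒬-form of the near feed -/

/-- the QUADRUPOLE MOMENT OF THE Q-EXCESS at scales `(r₀,r₁)`, seen from `x` along `e`:
`𝒬_{r₀r₁}(x,e) = ∫ K_ee(x − y) (q(t,y) − q(t,x)) dy`, `K_ee = ∂ₑ∂ₑ(θΓ)`, `q = qDensity = ½|ω|² − |S|²`. -/
def qExcessMoment (r₀ r₁ : ℝ) (u : ℝ → (EuclideanSpace ℝ (Fin 3)) → (EuclideanSpace ℝ (Fin 3))) (t : ℝ)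
    (x e : EuclideanSpace ℝ (Fin 3)) : ℝ :=
  ∫ y, newtonNearHess r₀ r₁ e e (x - y) * (qDensity u t y - qDensity u t x)

/-- `N_{r₀r₁}[∂ₑ∂ₑq](x) = 𝒬_{r₀r₁}(x,e)` in the door frame (localise `q`, CZ transfer on the localised density, undo the
localisation under the integral — steps (1)–(3) of `tfNearHess_eq_integral_sub`). -/
theorem newtonNearPotential_dd_eq_qExcessMoment {ν T : ℝ} {u : ℝ → (EuclideanSpace ℝ (Fin 3)) → (EuclideanSpace ℝ (Fin 3))}
    {p : ℝ → (EuclideanSpace ℝ (Fin 3)) → ℝ} (hsol : IsClassicalNSSolutionOn (Ico 0 T) ν 0 u p) {t : ℝ} (ht : t ∈ Ico 0 T)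
    {r₀ r₁ : ℝ} (hr₀ : 0 < r₀) (hr₁ : r₀ < r₁) (x e : EuclideanSpace ℝ (Fin 3)) :
    newtonNearPotential r₀ r₁ (fun w => fderiv ℝ (fun y => fderiv ℝ (qDensity u t) y e) w e) x = qExcessMoment r₀ r₁ u t x e := by
  have hS : UniqueDiffOn ℝ (Ico (0 : ℝ) T) := uniqueDiffOn_Ico 0 T
  have hΔs : ContDiff ℝ ∞ (fun y => (Δ (p t)) y) := (hsol.smooth_pressure.laplacian hS).contDiff_slice ht
  have hq : qDensity u t = fun y => (Δ (p t)) y := qDensity_eq_laplacian_pressure_fun hsol ht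
  have hq2 : ContDiff ℝ 2 (qDensity u t) := hq ▸ contDiff_infty.1 hΔs 2
  have hr1 : 0 ≤ r₁ + 1 := by linarith
  have hG2 : ContDiff ℝ 2 (qLoc r₁ u t x) := contDiff_qLoc hq2
  obtain ⟨C', hH⟩ := exists_holderWith_qLoc (r₁ := r₁) (x := x) hr1 hq2
  have h1 : newtonNearPotential r₀ r₁ (fun w => fderiv ℝ (fun y => fderiv ℝ (qDensity u t) y e) w e) x =
      newtonNearPotential r₀ r₁ (fun w => fderiv ℝ (fun y => fderiv ℝ (qLoc r₁ u t x) y e) w e) x := by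
    unfold newtonNearPotential
    refine integral_congr_ae (ae_of_all _ fun z => ?_)
    by_cases hz : r₁ ≤ ‖z‖
    · simp only [newtonNear_eq_zero hr₀.le hr₁ hz, zero_mul]
    · have hw : x - z ∈ ball x (r₁ + 1) := by
        rw [mem_ball_iff_norm, sub_sub_cancel_left, norm_neg]
        linarith [lt_of_not_ge hz]
      simp only [fderiv_fderiv_apply_eq_of_eventuallyEq (qLoc_eventuallyEq (u := u) (t := t) hr1 hw) e e]
  have h2 : newtonNearPotential r₀ r₁ (fun w => fderiv ℝ (fun y => fderiv ℝ (qLoc r₁ u t x) y e) w e) x =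
      czDiff (newtonNearHess r₀ r₁ e e) (qLoc r₁ u t x) x :=
    (czDiff_newtonNearHess_eq_newtonNearPotential hr₀ hr₁ hG2 hH (by norm_num) (by norm_num) e e x).symm
  have h3 : czDiff (newtonNearHess r₀ r₁ e e) (qLoc r₁ u t x) x = qExcessMoment r₀ r₁ u t x e := by
    unfold czDiff qExcessMoment
    refine integral_congr_ae (ae_of_all _ fun y => ?_)
    simp only [smul_eq_mul]
    by_cases hy : r₁ ≤ ‖x - y‖
    · simp only [newtonNearHess_eq_zero_of_le hr₀ hr₁ e e hy, zero_mul]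
    · have hyb : y ∈ ball x (r₁ + 1) := by
        rw [mem_ball_iff_norm, ← norm_neg, neg_sub]
        linarith [lt_of_not_ge hy]
      have hxb : x ∈ ball x (r₁ + 1) := mem_ball_self (by linarith)
      rw [qLoc_eq_of_mem_ball hr1 hyb, qLoc_eq_of_mem_ball hr1 hxb]
  rw [h1, h2, h3]

/-- ★ THE 𝒬-FORM: `newtonNearFeed = ¼(|ω|² − ω_e²) − 𝒬` (door frame, every `t ∈ [0,T)`, `x`, `e`). -/
theorem newtonNearFeed_eq_quarter_sub_qExcessMoment {ν T : ℝ} {u : ℝ → (EuclideanSpace ℝ (Fin 3)) → (EuclideanSpace ℝ (Fin 3))}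
    {p : ℝ → (EuclideanSpace ℝ (Fin 3)) → ℝ} (hsol : IsClassicalNSSolutionOn (Ico 0 T) ν 0 u p) {t : ℝ} (ht : t ∈ Ico 0 T)
    {r₀ r₁ : ℝ} (hr₀ : 0 < r₀) (hr₁ : r₀ < r₁) (x e : EuclideanSpace ℝ (Fin 3)) :
    newtonNearFeed r₀ r₁ u t x e =
      (1 / 4) * (‖curl (u t) x‖ ^ 2 - ⟪curl (u t) x, e⟫ ^ 2) - qExcessMoment r₀ r₁ u t x e := by
  unfold newtonNearFeed
  rw [newtonNearPotential_dd_eq_qExcessMoment hsol ht hr₀ hr₁ x e]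

/-- ★ D8's parity hypothesis in 𝒬-form: `newtonNearFeed ≤ λ²  ↔  ¼|ω⊥e|² − λ² ≤ 𝒬`. -/
theorem newtonNearFeed_le_sq_iff {ν T : ℝ} {u : ℝ → (EuclideanSpace ℝ (Fin 3)) → (EuclideanSpace ℝ (Fin 3))}
    {p : ℝ → (EuclideanSpace ℝ (Fin 3)) → ℝ} (hsol : IsClassicalNSSolutionOn (Ico 0 T) ν 0 u p) {t : ℝ} (ht : t ∈ Ico 0 T)
    {r₀ r₁ : ℝ} (hr₀ : 0 < r₀) (hr₁ : r₀ < r₁) (x e : EuclideanSpace ℝ (Fin 3)) :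
    newtonNearFeed r₀ r₁ u t x e ≤ strainQuad u t x e ^ 2 ↔
      (1 / 4) * (‖curl (u t) x‖ ^ 2 - ⟪curl (u t) x, e⟫ ^ 2) - strainQuad u t x e ^ 2 ≤ qExcessMoment r₀ r₁ u t x e := by
  rw [newtonNearFeed_eq_quarter_sub_qExcessMoment hsol ht hr₀ hr₁ x e]
  constructor <;> intro h <;> linarith

/-! ## §19  The magic-cone sign of the near kernel -/

/-- ★ MAGIC CONE: inside the inner radius, `K_ee(z) ≥ 0 ↔ 3⟨z,e⟩² ≤ |z|²` (polar angle from `±e` at least `arccos(1/√3)`). -/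
theorem newtonNearHess_self_nonneg_iff {r₀ r₁ : ℝ} (hr₀ : 0 ≤ r₀) (hr₁ : r₀ < r₁) {z e : EuclideanSpace ℝ (Fin 3)}
    (hz0 : z ≠ 0) (hz : ‖z‖ < r₀) (he : ‖e‖ = 1) :
    0 ≤ newtonNearHess r₀ r₁ e e z ↔ 3 * ⟪z, e⟫ ^ 2 ≤ ‖z‖ ^ 2 := by
  rw [newtonNearHess_self_eq_quadrupole hr₀ hr₁ hz0 hz e, he, one_pow, one_mul]
  have hzp : 0 < ‖z‖ := norm_pos_iff.2 hz0
  have hD : 0 < 4 * π * ‖z‖ ^ 5 := by positivity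
  constructor
  · intro h
    by_contra hlt
    have hneg : (‖z‖ ^ 2 - 3 * ⟪z, e⟫ ^ 2) / (4 * π * ‖z‖ ^ 5) < 0 := div_neg_of_neg_of_pos (by linarith) hD
    linarith
  · intro h
    exact div_nonneg (by linarith) hD.le

/-- inside the magic double cone the kernel FEEDS: `K_ee(z) < 0 ↔ |z|² < 3⟨z,e⟩²`. -/
theorem newtonNearHess_self_neg_iff {r₀ r₁ : ℝ} (hr₀ : 0 ≤ r₀) (hr₁ : r₀ < r₁) {z e : EuclideanSpace ℝ (Fin 3)}
    (hz0 : z ≠ 0) (hz : ‖z‖ < r₀) (he : ‖e‖ = 1) :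
    newtonNearHess r₀ r₁ e e z < 0 ↔ ‖z‖ ^ 2 < 3 * ⟪z, e⟫ ^ 2 := by
  rw [← not_le, newtonNearHess_self_nonneg_iff hr₀ hr₁ hz0 hz he, not_le]

/-- equatorial value (`z ⟂ e`): `K_ee(z) = +1/(4π|z|³)` — Q-excess in the plane orthogonal to the stretching direction COMPRESSES. -/
theorem newtonNearHess_self_of_inner_eq_zero {r₀ r₁ : ℝ} (hr₀ : 0 ≤ r₀) (hr₁ : r₀ < r₁) {z e : EuclideanSpace ℝ (Fin 3)}
    (hz0 : z ≠ 0) (hz : ‖z‖ < r₀) (he : ‖e‖ = 1) (h : ⟪z, e⟫ = 0) :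
    newtonNearHess r₀ r₁ e e z = 1 / (4 * π * ‖z‖ ^ 3) := by
  rw [newtonNearHess_self_eq_quadrupole hr₀ hr₁ hz0 hz e, he, h]
  have hzp : 0 < ‖z‖ := norm_pos_iff.2 hz0
  field_simp
  ring

/-- ★ THE 45° LAW (`⟨z,e⟩² = ½|z|²`, the direction at which a concentrated vortex induces its maximal strain):
`K_ee(z) = −1/(8π|z|³) < 0` — vortex-induced record strain is quadrupole-FED. -/
theorem newtonNearHess_self_of_sq_inner_eq_half {r₀ r₁ : ℝ} (hr₀ : 0 ≤ r₀) (hr₁ : r₀ < r₁) {z e : EuclideanSpace ℝ (Fin 3)}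
    (hz0 : z ≠ 0) (hz : ‖z‖ < r₀) (he : ‖e‖ = 1) (h : ⟪z, e⟫ ^ 2 = ‖z‖ ^ 2 / 2) :
    newtonNearHess r₀ r₁ e e z = -(1 / (8 * π * ‖z‖ ^ 3)) := by
  rw [newtonNearHess_self_eq_quadrupole hr₀ hr₁ hz0 hz e, he, h]
  have hzp : 0 < ‖z‖ := norm_pos_iff.2 hz0
  field_simp
  ring

/-- polar value (`z ∥ ±e`): `K_ee(z) = −1/(2π|z|³)` — Q-excess along the stretching direction feeds twice as hard. -/
theorem newtonNearHess_self_of_sq_inner_eq_sq {r₀ r₁ : ℝ} (hr₀ : 0 ≤ r₀) (hr₁ : r₀ < r₁) {z e : EuclideanSpace ℝ (Fin 3)}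
    (hz0 : z ≠ 0) (hz : ‖z‖ < r₀) (he : ‖e‖ = 1) (h : ⟪z, e⟫ ^ 2 = ‖z‖ ^ 2) :
    newtonNearHess r₀ r₁ e e z = -(1 / (2 * π * ‖z‖ ^ 3)) := by
  rw [newtonNearHess_self_eq_quadrupole hr₀ hr₁ hz0 hz e, he, h]
  have hzp : 0 < ‖z‖ := norm_pos_iff.2 hz0
  field_simp
  ring

/-- the 45° value is negative. -/
theorem newtonNearHess_self_neg_of_sq_inner_eq_half {r₀ r₁ : ℝ} (hr₀ : 0 ≤ r₀) (hr₁ : r₀ < r₁) {z e : EuclideanSpace ℝ (Fin 3)}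
    (hz0 : z ≠ 0) (hz : ‖z‖ < r₀) (he : ‖e‖ = 1) (h : ⟪z, e⟫ ^ 2 = ‖z‖ ^ 2 / 2) :
    newtonNearHess r₀ r₁ e e z < 0 := by
  rw [newtonNearHess_self_of_sq_inner_eq_half hr₀ hr₁ hz0 hz he h, neg_lt_zero]
  have hzp : 0 < ‖z‖ := norm_pos_iff.2 hz0
  positivity

/-! ## §20  Door D11 «MagicConeDoor» and the blow-up alternative -/

/-- door D11 «MagicConeDoor» (PROVED below from D8; forward, S38's Sobolev frame = D8's).  Classical unforced solution on
`[0,T)`, `H¹ ∩ Ḣ^m`-bounded on every `[0,T'']`, `T'' < T`; scales `0 < r₀ < r₁`.  IF on `[t₀,T)` at every `δ`-almost strain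
maximiser `(x,e)` charged above the level `l₀` (i) the Q-excess is FAVOURABLY SEGREGATED with respect to the magic cone of `e`,
`K_ee(x − y)(q(t,y) − q(t,x)) ≥ 0` for every `y` (excess outside the double cone, deficit inside), and (ii) the pointwise
restricted-Euler parity `|ω(x)|² − ω_e(x)² ≤ 4 λ_max²` holds, THEN the solution extends past `T` in the Sobolev class. -/
def MagicConeDoor : Prop :=
  ∀ (ν T t₀ l₀ δ r₀ r₁ : ℝ), 0 < ν → 0 ≤ t₀ → t₀ < T → 0 < l₀ → 0 < δ → δ < 1 → 0 < r₀ → r₀ < r₁ →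
    ∀ (u : ℝ → (EuclideanSpace ℝ (Fin 3)) → (EuclideanSpace ℝ (Fin 3)))
      (p : ℝ → (EuclideanSpace ℝ (Fin 3)) → ℝ),
      IsClassicalNSSolutionOn (Ico 0 T) ν 0 u p →
      (∀ T'' < T, HasBoundedSobolevNormsOn (Icc 0 T'') u) →
      (∀ t ∈ Ico t₀ T, ∀ (x e : EuclideanSpace ℝ (Fin 3)), IsStrainAlmostArgmax δ u t x e →
        l₀ < strainQuad u t x e →
          (∀ y, 0 ≤ newtonNearHess r₀ r₁ e e (x - y) * (qDensity u t y - qDensity u t x)) ∧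
            ‖curl (u t) x‖ ^ 2 - ⟪curl (u t) x, e⟫ ^ 2 ≤ 4 * strainQuad u t x e ^ 2) →
      HasSobolevExtensionPast ν u T

/-- door D11′ «QExcessParityDoor» (the 𝒬-FORM of D8 itself; PROVED equivalent to D8 below): hypothesis
`¼(|ω|² − ω_e²) − λ_max² ≤ 𝒬_{r₀r₁}(x,e)` at every charged `δ`-almost strain maximiser on `[t₀,T)`. -/
def QExcessParityDoor : Prop :=
  ∀ (ν T t₀ l₀ δ r₀ r₁ : ℝ), 0 < ν → 0 ≤ t₀ → t₀ < T → 0 < l₀ → 0 < δ → δ < 1 → 0 < r₀ → r₀ < r₁ →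
    ∀ (u : ℝ → (EuclideanSpace ℝ (Fin 3)) → (EuclideanSpace ℝ (Fin 3)))
      (p : ℝ → (EuclideanSpace ℝ (Fin 3)) → ℝ),
      IsClassicalNSSolutionOn (Ico 0 T) ν 0 u p →
      (∀ T'' < T, HasBoundedSobolevNormsOn (Icc 0 T'') u) →
      (∀ t ∈ Ico t₀ T, ∀ (x e : EuclideanSpace ℝ (Fin 3)), IsStrainAlmostArgmax δ u t x e →
        l₀ < strainQuad u t x e →
          (1 / 4) * (‖curl (u t) x‖ ^ 2 - ⟪curl (u t) x, e⟫ ^ 2) - strainQuad u t x e ^ 2 ≤ qExcessMoment r₀ r₁ u t x e) →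
      HasSobolevExtensionPast ν u T

/-- ★ D8 ⟺ D11′ (the 𝒬-form is a faithful restatement). -/
theorem qExcessParityDoor_iff_D8 : QExcessParityDoor ↔ LocalNewtonParityDoor := by
  constructor
  · intro h ν T t₀ l₀ δ r₀ r₁ hν ht₀ hT hl₀ hδ hδ1 hr₀ hr₁ u p hsol hreg hhyp
    refine h ν T t₀ l₀ δ r₀ r₁ hν ht₀ hT hl₀ hδ hδ1 hr₀ hr₁ u p hsol hreg fun t ht x e hax hl => ?_
    have ht' : t ∈ Ico 0 T := ⟨ht₀.trans ht.1, ht.2⟩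
    exact (newtonNearFeed_le_sq_iff hsol ht' hr₀ hr₁ x e).1 (hhyp t ht x e hax hl)
  · intro h ν T t₀ l₀ δ r₀ r₁ hν ht₀ hT hl₀ hδ hδ1 hr₀ hr₁ u p hsol hreg hhyp
    refine h ν T t₀ l₀ δ r₀ r₁ hν ht₀ hT hl₀ hδ hδ1 hr₀ hr₁ u p hsol hreg fun t ht x e hax hl => ?_
    have ht' : t ∈ Ico 0 T := ⟨ht₀.trans ht.1, ht.2⟩
    exact (newtonNearFeed_le_sq_iff hsol ht' hr₀ hr₁ x e).2 (hhyp t ht x e hax hl)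

/-- D11′ holds (⇐ D8 ⇐ B3). -/
theorem qExcessParityDoor_holds : QExcessParityDoor := qExcessParityDoor_iff_D8.2 localNewtonParityDoor_holds

/-- favourable segregation gives a non-negative quadrupole moment. -/
theorem qExcessMoment_nonneg_of_segregated {r₀ r₁ : ℝ} {u : ℝ → (EuclideanSpace ℝ (Fin 3)) → (EuclideanSpace ℝ (Fin 3))}
    {t : ℝ} {x e : EuclideanSpace ℝ (Fin 3)}
    (h : ∀ y, 0 ≤ newtonNearHess r₀ r₁ e e (x - y) * (qDensity u t y - qDensity u t x)) :
    0 ≤ qExcessMoment r₀ r₁ u t x e :=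
  integral_nonneg fun y => h y

/-- ★ D11 from D8. -/
theorem magicConeDoor_of_D8 (h8 : LocalNewtonParityDoor) : MagicConeDoor := by
  intro ν T t₀ l₀ δ r₀ r₁ hν ht₀ hT hl₀ hδ hδ1 hr₀ hr₁ u p hsol hreg hhyp
  refine h8 ν T t₀ l₀ δ r₀ r₁ hν ht₀ hT hl₀ hδ hδ1 hr₀ hr₁ u p hsol hreg fun t ht x e hax hl => ?_
  obtain ⟨hseg, hre⟩ := hhyp t ht x e hax hl
  have ht' : t ∈ Ico 0 T := ⟨ht₀.trans ht.1, ht.2⟩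
  have hQ : 0 ≤ qExcessMoment r₀ r₁ u t x e := qExcessMoment_nonneg_of_segregated hseg
  rw [newtonNearFeed_eq_quarter_sub_qExcessMoment hsol ht' hr₀ hr₁ x e]
  linarith

/-- ★★ D11 holds (⇐ D8 ⇐ B3, all in the tree). -/
theorem magicConeDoor_holds : MagicConeDoor := magicConeDoor_of_D8 localNewtonParityDoor_holds

/-- ★ THE BLOW-UP ALTERNATIVE (proved; contrapositive of D8 in 𝒬-form).  If a classical unforced solution on `[0,T)`, Sobolev-bounded
on every `[0,T'']`, does NOT extend past `T`, then for every `t₀ ∈ [0,T)`, level `l₀ > 0`, tolerance `δ ∈ (0,1)` and scales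
`0 < r₀ < r₁` there is a `δ`-almost strain maximiser charged above `l₀` at some `t ∈ [t₀,T)` exhibiting
(F1) TRANSVERSE VORTICITY `|ω|² − ω_e² > 4λ²` (layer-type)  or  (F2) FED GEOMETRY `𝒬_{r₀r₁}(x,e) < 0` (tube-type). -/
theorem blowup_alternative {ν T t₀ l₀ δ r₀ r₁ : ℝ} (hν : 0 < ν) (ht₀ : 0 ≤ t₀) (ht₀T : t₀ < T) (hl₀ : 0 < l₀) (hδ : 0 < δ)
    (hδ1 : δ < 1) (hr₀ : 0 < r₀) (hr₁ : r₀ < r₁) {u : ℝ → (EuclideanSpace ℝ (Fin 3)) → (EuclideanSpace ℝ (Fin 3))}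
    {p : ℝ → (EuclideanSpace ℝ (Fin 3)) → ℝ} (hsol : IsClassicalNSSolutionOn (Ico 0 T) ν 0 u p)
    (hreg : ∀ T'' < T, HasBoundedSobolevNormsOn (Icc 0 T'') u) (hblow : ¬ HasSobolevExtensionPast ν u T) :
    ∃ t ∈ Ico t₀ T, ∃ (x e : EuclideanSpace ℝ (Fin 3)), IsStrainAlmostArgmax δ u t x e ∧ l₀ < strainQuad u t x e ∧
      (4 * strainQuad u t x e ^ 2 < ‖curl (u t) x‖ ^ 2 - ⟪curl (u t) x, e⟫ ^ 2 ∨ qExcessMoment r₀ r₁ u t x e < 0) := by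
  by_contra hcon
  push Not at hcon
  refine hblow (localNewtonParityDoor_holds ν T t₀ l₀ δ r₀ r₁ hν ht₀ ht₀T hl₀ hδ hδ1 hr₀ hr₁ u p hsol hreg
    fun t ht x e hax hl => ?_)
  obtain ⟨h1, h2⟩ := hcon t ht x e hax hl
  have ht' : t ∈ Ico 0 T := ⟨ht₀.trans ht.1, ht.2⟩
  rw [newtonNearFeed_eq_quarter_sub_qExcessMoment hsol ht' hr₀ hr₁ x e]
  linarith

/-- the alternative at charged points where the vorticity is NOT too transverse: the geometry must feed (`𝒬 < 0`). -/
theorem blowup_fed_geometry {ν T t₀ l₀ δ r₀ r₁ : ℝ} (hν : 0 < ν) (ht₀ : 0 ≤ t₀) (ht₀T : t₀ < T) (hl₀ : 0 < l₀) (hδ : 0 < δ)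
    (hδ1 : δ < 1) (hr₀ : 0 < r₀) (hr₁ : r₀ < r₁) {u : ℝ → (EuclideanSpace ℝ (Fin 3)) → (EuclideanSpace ℝ (Fin 3))}
    {p : ℝ → (EuclideanSpace ℝ (Fin 3)) → ℝ} (hsol : IsClassicalNSSolutionOn (Ico 0 T) ν 0 u p)
    (hreg : ∀ T'' < T, HasBoundedSobolevNormsOn (Icc 0 T'') u) (hblow : ¬ HasSobolevExtensionPast ν u T)
    (hF1 : ∀ t ∈ Ico t₀ T, ∀ (x e : EuclideanSpace ℝ (Fin 3)), IsStrainAlmostArgmax δ u t x e → l₀ < strainQuad u t x e →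
      ‖curl (u t) x‖ ^ 2 - ⟪curl (u t) x, e⟫ ^ 2 ≤ 4 * strainQuad u t x e ^ 2) :
    ∃ t ∈ Ico t₀ T, ∃ (x e : EuclideanSpace ℝ (Fin 3)), IsStrainAlmostArgmax δ u t x e ∧ l₀ < strainQuad u t x e ∧
      qExcessMoment r₀ r₁ u t x e < 0 := by
  obtain ⟨t, ht, x, e, hax, hl, halt⟩ := blowup_alternative hν ht₀ ht₀T hl₀ hδ hδ1 hr₀ hr₁ hsol hreg hblow
  refine ⟨t, ht, x, e, hax, hl, ?_⟩
  rcases halt with h | h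
  · exact absurd (hF1 t ht x e hax hl) (not_le.2 h)
  · exact h

/-! ## §21  The stretched shear layer: the F1-defect is `α·λ` exactly -/

/-- the strain form of the stretched shear layer `∇u = [[−α,0,0],[κ,0,0],[0,0,α]]` on a unit vector `(a,b,c)` is
`−αa² + αc² + κab`; if `l ≥ α ≥ 0` solves `l² + αl = κ²/4` then `l` bounds it (SOS identity
`(l+α)(l − f) = ((l+α)a − (κ/2)b)² + (l² − α²)c²`). -/
theorem layerStrain_le {α κ l : ℝ} (hα : 0 ≤ α) (hαl : α ≤ l) (hl : l ^ 2 + α * l = κ ^ 2 / 4) (a b c : ℝ)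
    (h1 : a ^ 2 + b ^ 2 + c ^ 2 = 1) : -α * a ^ 2 + α * c ^ 2 + κ * a * b ≤ l := by
  have key : (l + α) * (l - (-α * a ^ 2 + α * c ^ 2 + κ * a * b)) =
      ((l + α) * a - (κ / 2) * b) ^ 2 + (l ^ 2 - α ^ 2) * c ^ 2 + (l * (l + α) - κ ^ 2 / 4) * b ^ 2 +
        (l + α) * l * (1 - (a ^ 2 + b ^ 2 + c ^ 2)) := by ring
  have key' : (l + α) * (l - (-α * a ^ 2 + α * c ^ 2 + κ * a * b)) =
      ((l + α) * a - (κ / 2) * b) ^ 2 + (l ^ 2 - α ^ 2) * c ^ 2 := by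
    rw [key, h1, show l * (l + α) - κ ^ 2 / 4 = 0 by linarith]
    ring
  have hla : 0 ≤ l ^ 2 - α ^ 2 := by nlinarith
  have hnn : 0 ≤ (l + α) * (l - (-α * a ^ 2 + α * c ^ 2 + κ * a * b)) := by
    rw [key']
    exact add_nonneg (sq_nonneg _) (mul_nonneg hla (sq_nonneg _))
  rcases eq_or_lt_of_le (add_nonneg (hα.trans hαl) hα : 0 ≤ l + α) with h0 | hpos
  · have hl0 : l = 0 := by linarith
    have ha0 : α = 0 := by linarith
    have hκ : κ ^ 2 = 0 := by rw [hl0, ha0] at hl; linarith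
    have hκ0 : κ = 0 := pow_eq_zero_iff (n := 2) (by norm_num) |>.1 hκ
    rw [hl0, ha0, hκ0]
    linarith
  · exact sub_nonneg.1 ((mul_nonneg_iff_of_pos_left hpos).1 hnn)

/-- … and `l` is ATTAINED in the plane `c = 0` at `(a,b) ∝ (κ/2, l+α)` — so `l` IS the record strain of the layer. -/
theorem layerStrain_eq {α κ l a b : ℝ} (hα : 0 ≤ α) (hαl : α ≤ l) (hl : l ^ 2 + α * l = κ ^ 2 / 4)
    (hab : (l + α) * a = (κ / 2) * b) (h1 : a ^ 2 + b ^ 2 = 1) : -α * a ^ 2 + κ * a * b = l := by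
  have key : (l + α) * (l - (-α * a ^ 2 + κ * a * b)) =
      ((l + α) * a - (κ / 2) * b) ^ 2 + (l * (l + α) - κ ^ 2 / 4) * b ^ 2 + (l + α) * l * (1 - (a ^ 2 + b ^ 2)) := by ring
  have hsq : ((l + α) * a - (κ / 2) * b) ^ 2 = 0 := by rw [hab, sub_self]; ring
  have key' : (l + α) * (l - (-α * a ^ 2 + κ * a * b)) = 0 := by
    rw [key, hsq, h1, show l * (l + α) - κ ^ 2 / 4 = 0 by linarith]
    ring
  rcases eq_or_lt_of_le (add_nonneg (hα.trans hαl) hα : 0 ≤ l + α) with h0 | hpos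
  · have hl0 : l = 0 := by linarith
    have ha0 : α = 0 := by linarith
    have hκ : κ ^ 2 = 0 := by rw [hl0, ha0] at hl; linarith
    have hκ0 : κ = 0 := pow_eq_zero_iff (n := 2) (by norm_num) |>.1 hκ
    rw [hl0, ha0, hκ0]
    ring
  · rcases mul_eq_zero.1 key' with h | h
    · exact absurd h hpos.ne'
    · linarith

/-- ★ THE α·λ LAW: with the layer's record strain `l` (`l² + αl = κ²/4`) and its vorticity `ω = (0,0,κ)` orthogonal to the
maximiser, the F1-defect `¼|ω⊥e|² − l² = κ²/4 − l²` equals `α·l` exactly (positive as soon as `α, l > 0`): every stretched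
shear layer violates local parity at its record strain, at all scales, by the product of background and record strain. -/
theorem layer_defect {α κ l : ℝ} (hl : l ^ 2 + α * l = κ ^ 2 / 4) : κ ^ 2 / 4 - l ^ 2 = α * l := by
  linarith

/-- the rational instance `α = 7`, `κ = 24`, `l = 9`, maximiser `e = (3/5, 4/5, 0)`: strain `9`, defect `144 − 81 = 63 = 7·9`. -/
example : -(7 : ℝ) * (3 / 5) ^ 2 + 24 * (3 / 5) * (4 / 5) = 9 ∧ (24 : ℝ) ^ 2 / 4 - 9 ^ 2 = 7 * 9 := by
  constructor <;> norm_num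

end Summit.NavierStokesRegularity.NavierStokesRegularity.Theorems.StrainDoors
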